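import Literature.AlgebraicGeometry.AbelianSchemes.AbelianSchemeDualPairBaseChange
import HarnessLib

/-!
# The `∃!` of classifying maps along a base change `S′ → S`: solutions over `S` for `(T, f′ ≫ g)` ARE solutions over `S′`
# for `(T, f′)` ([MilneAV2008] I §8; [MumfordFogartyKirwan1994] Ch. 6 §1 Cor. 6.8 «the dual commutes with base change»)

Layer `Literature/AlgebraicGeometry/AbelianSchemes`, namespace `Literature.AlgebraicGeometry.AbelianSchemes.AbelianSchemeOver`.
THEOREMS ONLY (no definition, no named fact, no instance, no notation, no `sorry`).

Setting of ★ `PoincareUniversalLocality` / ★ `AbelianSchemeDualPairBaseChange` §3, but for an ARBITRARY would-be dual `B` (no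
`DualPair`, i.e. no universality assumed): abelian schemes `A`, `B` over `S`, a module `P` on `A ×_S B`, a morphism `g : S′ → S`,
and ANY comparison morphism `c : A_{S′} ×_{S′} B_{S′} → A ×_S B` with the two projections of ★ `DualPair.prodBaseChangeToProd`
(hypotheses `hc₁`, `hc₂`; the map is unique, only these equations are used).  For a test datum `(f′ : T → S′, ℒ)` on `(A_{S′})_T`
the SOLUTIONS `g′ : T → B_{S′}` over `f′` with `(1 × g′)^* c^*P ≅ ℒ` correspond to the solutions `g₀ : T → B` over `f′ ≫ g` with
`(1 × g₀)^*P ≅ ℒ.alongBaseChange` (★ `RigidifiedLineBundle.alongBaseChange`: `ℒ` read on `A_{f′ ≫ g} ≅ (A_{S′})_{f′}`) under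
`g′ ↦ g′ ≫ pr_B`, `g₀ ↦ (g₀, f′)`:

* `comp_fst_comp_hom_of_over'` — `(g′ ≫ pr_B) ≫ π_B = f′ ≫ g`;
* `baseChangeToProd_baseChange_comp_eq` — the square `(1_{A_{S′}} × g′) ≫ c = e⁻¹ ≫ (1_A × (g′ ≫ pr_B))`;
* `nonempty_solution_iso_of_baseChange` / `nonempty_solution_iso_baseChange_of` — the two transports of the solution isomorphism;
* **`existsUnique_classify_baseChange_of_existsUnique`** (`∃!` over `S` at `(f′ ≫ g, ℒ.alongBaseChange)` ⇒ `∃!` over `S′` at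
  `(f′, ℒ)` — the proof of ★ `DualPair.universal_baseChange` with the classifying map as a hypothesis) and the converse
  **`existsUnique_classify_of_existsUnique_baseChange`**; `existsUnique_classify_baseChange_iff`.

Consumer: the F-3 (Mc) node N0′ «affine finite type ⇒ all» over an AFFINE Noetherian base `S′` — transport of the classification
problem along `S′ ≅ Spec Γ(S′, 𝒪)` to the `Spec`-base limit descent (cell `hodgecm-mathlib`, D-0151, FLOOR 0 P1, grandchild line
`Cruxes/HDel/Lines/F3DualAbelianSchemeMc`, stub `stub_McN0`).  Count-neutral; HC_CM is proved only modulo the 7 printed citations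
until rung 0 closes; nothing here is about HC.

Mathlib searched (pin): `pullback.lift_fst/snd`, `pullback.hom_ext`; ★ `AbelianSchemeBaseChangeComp` (`bcHomLeft`, `bcInvLeft`,
`pullbackHomPullbackInvIso`, `pullbackInvPullbackHomIso`, `baseChangeCompGrpIso_inv_left_fst/snd`) (used).

## References
* [MilneAV2008] J. S. Milne, *Abelian Varieties* (v2.00, 2008), I §8 pp. 36–37.
* [MumfordFogartyKirwan1994] D. Mumford, J. Fogarty, F. Kirwan, *Geometric Invariant Theory*, 3rd ed. (1994), Ch. 6 §1 Cor. 6.8 (p. 118).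
* [GortzWedhorn2020] U. Görtz, T. Wedhorn, *Algebraic Geometry I*, 2nd ed. (2020), Section (4.7) (pp. 107–108).
-/

noncomputable section

set_option backward.isDefEq.respectTransparency false

universe u

open CategoryTheory CategoryTheory.Limits AlgebraicGeometry

namespace Literature.AlgebraicGeometry.AbelianSchemes

namespace AbelianSchemeOver

open Literature.AlgebraicGeometry.Modules

variable {S S' T : Scheme.{u}} (A B : AbelianSchemeOver S) (P : (A.prodLeft B).Modules) (g : S' ⟶ S) (f' : T ⟶ S')

/-! ### §1 The comparison square for `1 × g′` -/

/-- The base point over `S` of an `S′`-morphism `g′ : T → B_{S′}` over `f′`: `(g′ ≫ pr_B) ≫ π_B = f′ ≫ g` (★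
`DualPair.comp_fst_comp_hat_hom_of_over` for any `B`). [cite: MilneAV2008, I §8 pp. 36–37] -/
theorem comp_fst_comp_hom_of_over' (g' : T ⟶ (B.baseChange g).X.left) (hg' : g' ≫ (B.baseChange g).X.hom = f') :
    (g' ≫ pullback.fst B.X.hom g) ≫ B.X.hom = f' ≫ g :=
  (Category.assoc _ _ _).trans ((congrArg (fun k => g' ≫ k) (pullback.condition (f := B.X.hom) (g := g))).trans
    ((Category.assoc _ _ _).symm.trans (congrArg (· ≫ g) hg')))

variable (c : (A.baseChange g).prodLeft (B.baseChange g) ⟶ A.prodLeft B)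
  (hc₁ : c ≫ pullback.fst A.X.hom B.X.hom =
    pullback.fst (A.baseChange g).X.hom (B.baseChange g).X.hom ≫ pullback.fst A.X.hom g)
  (hc₂ : c ≫ pullback.snd A.X.hom B.X.hom =
    pullback.snd (A.baseChange g).X.hom (B.baseChange g).X.hom ≫ pullback.fst B.X.hom g)

include hc₁ hc₂

/-- **The comparison square for `1 × g′`**: for an `S′`-morphism `g′ : T → B_{S′}` over `f′` and any comparison map `c` with the
two projections of `A_{S′} ×_{S′} B_{S′} → A ×_S B`, `(1_{A_{S′}} × g′) ≫ c = e⁻¹ ≫ (1_A × (g′ ≫ pr_B))` with `e⁻¹ : (A_{S′})_{f′} →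
A_{f′ ≫ g}` (★ `bcInvLeft`). [cite: MilneAV2008, I §8 pp. 36–37] [cite: GortzWedhorn2020, Section (4.7) (pp. 107–108)] -/
theorem baseChangeToProd_baseChange_comp_eq (g' : T ⟶ (B.baseChange g).X.left) (hg' : g' ≫ (B.baseChange g).X.hom = f') :
    (A.baseChange g).baseChangeToProd (B.baseChange g) f' g' hg' ≫ c =
      A.bcInvLeft g f' ≫ A.baseChangeToProd B (f' ≫ g) (g' ≫ pullback.fst B.X.hom g)
        (comp_fst_comp_hom_of_over' B g f' g' hg') := by
  apply pullback.hom_ext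
  · rw [Category.assoc, hc₁, baseChangeToProd_fst_assoc, Category.assoc, baseChangeToProd_fst]
    exact (A.baseChangeCompGrpIso_inv_left_fst g f').symm
  · rw [Category.assoc, hc₂, baseChangeToProd_snd_assoc, Category.assoc, baseChangeToProd_snd,
      A.baseChangeCompGrpIso_inv_left_snd_assoc g f']
    rfl

/-- `(1 × g′)^* c^* P ≅ (e⁻¹)^* (1 × (g′ ≫ pr_B))^* P`. [cite: MilneAV2008, I §8 pp. 36–37] -/
theorem nonempty_pullback_baseChangeToProd_pullback_iso (g' : T ⟶ (B.baseChange g).X.left)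
    (hg' : g' ≫ (B.baseChange g).X.hom = f') :
    Nonempty ((Scheme.Modules.pullback ((A.baseChange g).baseChangeToProd (B.baseChange g) f' g' hg')).obj
        ((Scheme.Modules.pullback c).obj P) ≅
      (Scheme.Modules.pullback (A.bcInvLeft g f')).obj
        ((Scheme.Modules.pullback (A.baseChangeToProd B (f' ≫ g) (g' ≫ pullback.fst B.X.hom g)
          (comp_fst_comp_hom_of_over' B g f' g' hg'))).obj P)) :=
  ⟨(Scheme.Modules.pullbackComp _ _).app P ≪≫
    (Scheme.Modules.pullbackCongr (A.baseChangeToProd_baseChange_comp_eq B g f' c hc₁ hc₂ g' hg')).app P ≪≫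
    ((Scheme.Modules.pullbackComp _ _).app P).symm⟩

/-! ### §2 Solutions over `S′` versus solutions over `S` -/

/-- **A solution over `S′` gives a solution over `S`**: if `g′ : T → B_{S′}` over `f′` has `(1 × g′)^* c^*P ≅ ℒ`, then
`g′ ≫ pr_B` has `(1 × (g′ ≫ pr_B))^*P ≅ ℒ.alongBaseChange` (`= e^*ℒ`). [cite: MilneAV2008, I §8 pp. 36–37] -/
theorem nonempty_solution_iso_of_baseChange (ℒ : (A.baseChange g).RigidifiedLineBundle f')
    (g' : T ⟶ (B.baseChange g).X.left) (hg' : g' ≫ (B.baseChange g).X.hom = f')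
    (h : Nonempty ((Scheme.Modules.pullback ((A.baseChange g).baseChangeToProd (B.baseChange g) f' g' hg')).obj
      ((Scheme.Modules.pullback c).obj P) ≅ ℒ.L)) :
    Nonempty ((Scheme.Modules.pullback (A.baseChangeToProd B (f' ≫ g) (g' ≫ pullback.fst B.X.hom g)
        (comp_fst_comp_hom_of_over' B g f' g' hg'))).obj P ≅ ℒ.alongBaseChange.L) := by
  obtain ⟨i⟩ := h
  obtain ⟨j⟩ := A.nonempty_pullback_baseChangeToProd_pullback_iso B P g f' c hc₁ hc₂ g' hg'
  -- `(1 × γ)^*P ≅ e^* (e⁻¹)^* (1 × γ)^*P ≅ e^* (1 × g')^* c^*P ≅ e^* ℒ`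
  exact ⟨(A.pullbackHomPullbackInvIso g f' _).symm ≪≫ (Scheme.Modules.pullback (A.bcHomLeft g f')).mapIso (j.symm ≪≫ i)⟩

/-- **A solution over `S` gives a solution over `S′`**: if `g₀ : T → B` over `f′ ≫ g` has `(1 × g₀)^*P ≅ ℒ.alongBaseChange`, then
`(g₀, f′) : T → B ×_S S′ = B_{S′}` has `(1 × (g₀, f′))^* c^*P ≅ ℒ`. [cite: MilneAV2008, I §8 pp. 36–37] -/
theorem nonempty_solution_iso_baseChange_of (ℒ : (A.baseChange g).RigidifiedLineBundle f')
    (g₀ : T ⟶ B.X.left) (hg₀ : g₀ ≫ B.X.hom = f' ≫ g)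
    (h : Nonempty ((Scheme.Modules.pullback (A.baseChangeToProd B (f' ≫ g) g₀ hg₀)).obj P ≅ ℒ.alongBaseChange.L)) :
    Nonempty ((Scheme.Modules.pullback ((A.baseChange g).baseChangeToProd (B.baseChange g) f'
        (pullback.lift g₀ f' hg₀) (pullback.lift_snd g₀ f' hg₀))).obj ((Scheme.Modules.pullback c).obj P) ≅ ℒ.L) := by
  obtain ⟨i⟩ := h
  have hγ : pullback.lift g₀ f' hg₀ ≫ pullback.fst B.X.hom g = g₀ := pullback.lift_fst _ _ _
  obtain ⟨j⟩ := A.nonempty_pullback_baseChangeToProd_pullback_iso B P g f' c hc₁ hc₂ (pullback.lift g₀ f' hg₀)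
    (pullback.lift_snd g₀ f' hg₀)
  -- `(1 × (g₀, f'))^* c^*P ≅ (e⁻¹)^* (1 × g₀)^*P ≅ (e⁻¹)^* e^* ℒ ≅ ℒ`
  exact ⟨j ≪≫ (Scheme.Modules.pullback (A.bcInvLeft g f')).mapIso
      (eqToIso (congrArg (fun k => (Scheme.Modules.pullback k).obj P)
        (A.baseChangeToProd_congr B (f' ≫ g) hγ _ hg₀)) ≪≫ i) ≪≫
    A.pullbackInvPullbackHomIso g f' ℒ.L⟩

/-! ### §3 `∃!` over `S′` from `∃!` over `S`, and conversely -/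

/-- **`∃!` of classifying maps over `S′` from `∃!` over `S`** ([MilneAV2008] I §8: restricting the universal property to the
`S`-schemes through `S′`; the proof of ★ `DualPair.universal_baseChange` with the classifying map over `S` as a HYPOTHESIS): if
the test datum `(f′ ≫ g, ℒ.alongBaseChange)` on `A_{f′ ≫ g}` has a UNIQUE classifying map `g₀ : T → B` for `P`, then
`(f′, ℒ)` on `(A_{S′})_{f′}` has a unique classifying map `T → B_{S′}` for `c^*P` — namely `(g₀, f′)`.
[cite: MilneAV2008, I §8 pp. 36–37] [cite: MumfordFogartyKirwan1994, Ch. 6 §1 Cor. 6.8 (p. 118)] -/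
theorem existsUnique_classify_baseChange_of_existsUnique (ℒ : (A.baseChange g).RigidifiedLineBundle f')
    (h : ∃! g₀ : {g₀ : T ⟶ B.X.left // g₀ ≫ B.X.hom = f' ≫ g},
      Nonempty ((Scheme.Modules.pullback (A.baseChangeToProd B (f' ≫ g) g₀.1 g₀.2)).obj P ≅ ℒ.alongBaseChange.L)) :
    ∃! g' : {g' : T ⟶ (B.baseChange g).X.left // g' ≫ (B.baseChange g).X.hom = f'},
      Nonempty ((Scheme.Modules.pullback ((A.baseChange g).baseChangeToProd (B.baseChange g) f' g'.1 g'.2)).obj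
        ((Scheme.Modules.pullback c).obj P) ≅ ℒ.L) := by
  obtain ⟨⟨g₀, hg₀⟩, e₀, huniq⟩ := h
  refine ⟨⟨pullback.lift g₀ f' hg₀, pullback.lift_snd _ _ _⟩,
    A.nonempty_solution_iso_baseChange_of B P g f' c hc₁ hc₂ ℒ g₀ hg₀ e₀, ?_⟩
  rintro ⟨g', hg'⟩ e'
  have hγ : g' ≫ pullback.fst B.X.hom g = g₀ :=
    congrArg Subtype.val (huniq ⟨g' ≫ pullback.fst B.X.hom g, comp_fst_comp_hom_of_over' B g f' g' hg'⟩
      (A.nonempty_solution_iso_of_baseChange B P g f' c hc₁ hc₂ ℒ g' hg' e'))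
  apply Subtype.ext
  apply pullback.hom_ext
  · rw [pullback.lift_fst]; exact hγ
  · rw [pullback.lift_snd]; exact hg'

/-- **`∃!` of classifying maps over `S` (for test schemes through `S′`) from `∃!` over `S′`**: if `(f′, ℒ)` on `(A_{S′})_{f′}` has a
UNIQUE classifying map `T → B_{S′}` for `c^*P`, then `(f′ ≫ g, ℒ.alongBaseChange)` on `A_{f′ ≫ g}` has a unique classifying map
`T → B` for `P`. [cite: MilneAV2008, I §8 pp. 36–37] [cite: MumfordFogartyKirwan1994, Ch. 6 §1 Cor. 6.8 (p. 118)] -/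
theorem existsUnique_classify_of_existsUnique_baseChange (ℒ : (A.baseChange g).RigidifiedLineBundle f')
    (h : ∃! g' : {g' : T ⟶ (B.baseChange g).X.left // g' ≫ (B.baseChange g).X.hom = f'},
      Nonempty ((Scheme.Modules.pullback ((A.baseChange g).baseChangeToProd (B.baseChange g) f' g'.1 g'.2)).obj
        ((Scheme.Modules.pullback c).obj P) ≅ ℒ.L)) :
    ∃! g₀ : {g₀ : T ⟶ B.X.left // g₀ ≫ B.X.hom = f' ≫ g},
      Nonempty ((Scheme.Modules.pullback (A.baseChangeToProd B (f' ≫ g) g₀.1 g₀.2)).obj P ≅ ℒ.alongBaseChange.L) := by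
  obtain ⟨⟨g', hg'⟩, e', huniq⟩ := h
  refine ⟨⟨g' ≫ pullback.fst B.X.hom g, comp_fst_comp_hom_of_over' B g f' g' hg'⟩,
    A.nonempty_solution_iso_of_baseChange B P g f' c hc₁ hc₂ ℒ g' hg' e', ?_⟩
  rintro ⟨g₀, hg₀⟩ e₀
  have hγ : pullback.lift g₀ f' hg₀ = g' :=
    congrArg Subtype.val (huniq ⟨pullback.lift g₀ f' hg₀, pullback.lift_snd _ _ _⟩
      (A.nonempty_solution_iso_baseChange_of B P g f' c hc₁ hc₂ ℒ g₀ hg₀ e₀))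
  apply Subtype.ext
  change g₀ = g' ≫ pullback.fst B.X.hom g
  rw [← hγ, pullback.lift_fst]

/-- **Solutions over `S′` for `(f′, ℒ)` ⟺ solutions over `S` for `(f′ ≫ g, ℒ.alongBaseChange)`** (the two directions together).
[cite: MilneAV2008, I §8 pp. 36–37] [cite: MumfordFogartyKirwan1994, Ch. 6 §1 Cor. 6.8 (p. 118)] -/
theorem existsUnique_classify_baseChange_iff (ℒ : (A.baseChange g).RigidifiedLineBundle f') :
    (∃! g' : {g' : T ⟶ (B.baseChange g).X.left // g' ≫ (B.baseChange g).X.hom = f'},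
      Nonempty ((Scheme.Modules.pullback ((A.baseChange g).baseChangeToProd (B.baseChange g) f' g'.1 g'.2)).obj
        ((Scheme.Modules.pullback c).obj P) ≅ ℒ.L)) ↔
    ∃! g₀ : {g₀ : T ⟶ B.X.left // g₀ ≫ B.X.hom = f' ≫ g},
      Nonempty ((Scheme.Modules.pullback (A.baseChangeToProd B (f' ≫ g) g₀.1 g₀.2)).obj P ≅ ℒ.alongBaseChange.L) :=
  ⟨A.existsUnique_classify_of_existsUnique_baseChange B P g f' c hc₁ hc₂ ℒ,
    A.existsUnique_classify_baseChange_of_existsUnique B P g f' c hc₁ hc₂ ℒ⟩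

end AbelianSchemeOver

end Literature.AlgebraicGeometry.AbelianSchemes

end
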